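import Mathlib
import Summits.CriticalPhenomena.CardyFormulaZ2.Theorems.CardyMagicRigidityDefs
import Summits.CriticalPhenomena.CardyFormulaZ2.Theorems.CardyMagicRigidityNestingRigidityTowerCountMeasurable
import Summits.CriticalPhenomena.CardyFormulaZ2.Theorems.CardyMagicRigidityNestingRigidityTowerPressureSanity
import HarnessLib

/-!
# Negative / tightness lemmas for stubs S2 `TowerPressureFamily` and S3 `ChargeQuantisation`
# of line `ring-cloud-tomography` (crux `NestingRigidity`, stmt-CriticalPhenomena-4835)

Refuter file (drefute gen 2, `refuter-drefute-stmt-CriticalPhenomena-4835-g2-0`). Nothing here asserts a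
route statement; every theorem is a CONSTRAINT on the witnesses the stubs quantify over.

§1 `LoopEnsemble.HasTowerPressure.antitoneOn` — on both lattice ensembles ANY sandwich-form tower
pressure on a set of non-negative weights is antitone (`u ↦ E_δ[u^N]` is monotone; a positive lower
sandwich bound makes the larger moment honestly integrable, so no integrability hypothesis is needed).

§2–§3 `not_hasTowerPressure_pressureFamily_of_lt` — consequently the witness `a` of S2
(`∃ a, E.HasTowerPressure (pressureFamily a) (Icc 0 √3)`) satisfies `1/(4π) ≤ a` on both lattices:
`pressureFamily a` has derivative `1/(4π) − a` at the right end-point `u = √3`, and an antitone function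
has non-positive left slopes there. So every `a < 1/(4π)` is EXCLUDED for free (half of the way from
`a = 0` to the quantised value `1/(2π)` of S3), with no cloud law and no percolation estimate.

§4 the branch point `u = 2`: `pressureFamily a u − e6 u = (a − 1/(2π))·(arccos(u/2) − π/3)`, so for
`a ≠ 1/(2π)` the family member is NOT left-Lipschitz at `u = 2` (`pressureFamily_not_leftLipschitz_two`,
square-root singularity of `arccos` at `1`), whereas `e6` is (`e6_sub_e6_two_le`, constant `3/16`).
Hence (`eq_inv_two_pi_of_leftLipschitz`) S3 follows from S2 as soon as the true pressure of the ensemble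
is known to extend to ANY function that is Lipschitz from the left at `u = 2` and agrees with the family on
a left neighbourhood of `2` — the common algebraic core of the three quantisation devices listed in the
S3 docstring (two charges with equal weight / concavity at the branch point / analytic perturbation theory).

§5 `LoopEnsemble.HasTowerPressure.add_le_two_mul` — tower pressures are midpoint-concave in `log u`
(Cauchy–Schwarz `E[√(uv)^N]² ≤ E[u^N] E[v^N]`, `towerMoment_sqrt_mul_sq_le`): `e u + e v ≤ 2 e(√(uv))` whenever
the three weights lie in the (non-negative) weight set. This is the Hölder lever behind the sharper necessary
condition `a ≥ 1/(2π) − (3/2π²)(π/6 − √3/4) ≈ 0.1454` for the S2 witness (second-order expansion at `u → √3⁻`,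
not formalised here); at the golden triple `(2cos(2π/5), 1, 2cos(π/5))` it reproduces `a ≥ 1/(4π)`.
-/

noncomputable section

open MeasureTheory Set Filter Metric
open scoped Real Topology BigOperators

namespace Summit.CriticalPhenomena.CardyFormulaZ2.Cruxes.NestingRigidity.RingCloudTomography

open Literature.Probability.RandomPlanarGeometry Literature.Probability.Percolation
  Literature.Probability.LatticeModels

/-! ## §1 Monotonicity of tower moments and antitonicity of tower pressures -/

/-- On a lattice ensemble the tower moment is monotone in the weight on `[0, ∞)`, as soon as the
larger weight has an integrable integrand. -/
theorem towerMoment_mono {E : LoopEnsemble} (hE : E ∈ latticeEnsembles) (δ ρ : ℝ) {u v : ℝ}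
    (hu : 0 ≤ u) (huv : u ≤ v) (hv : Integrable (fun ω ↦ v ^ towerCount (E.X δ ω) 0 ρ 1) E.P) :
    E.towerMoment u δ ρ ≤ E.towerMoment v δ ρ := by
  have hmeas : AEStronglyMeasurable (fun ω ↦ u ^ towerCount (E.X δ ω) 0 ρ 1) E.P :=
    ((measurable_towerCount E hE δ 0 ρ 1).const_pow u).aestronglyMeasurable
  have hu_int : Integrable (fun ω ↦ u ^ towerCount (E.X δ ω) 0 ρ 1) E.P := by
    refine hv.mono hmeas (Eventually.of_forall fun ω ↦ ?_)
    rw [Real.norm_eq_abs, Real.norm_eq_abs, abs_of_nonneg (pow_nonneg hu _),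
      abs_of_nonneg (pow_nonneg (hu.trans huv) _)]
    exact pow_le_pow_left₀ hu huv _
  exact integral_mono hu_int hv fun ω ↦ pow_le_pow_left₀ hu huv _

/-- A non-zero tower moment has an integrable integrand (Bochner junk is `0`). -/
theorem integrable_of_towerMoment_ne_zero {E : LoopEnsemble} {v δ ρ : ℝ} (h : E.towerMoment v δ ρ ≠ 0) :
    Integrable (fun ω ↦ v ^ towerCount (E.X δ ω) 0 ρ 1) E.P := by
  by_contra hni
  exact h (integral_undef hni)

/-- **Tower pressures are antitone.** For both lattice ensembles, any exponent function in sandwich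
form on a set `S` of non-negative weights is antitone on `S`: if `u ≤ v` had `e u < e v`, the sandwiches
at a common small `(ρ, δ)` with `ε = (e v − e u)/4` would give
`ρ^{e u+ε} ≤ E[u^N] ≤ E[v^N] ≤ ρ^{e v−ε}`, i.e. `e v − ε ≤ e u + ε`. -/
theorem LoopEnsemble.HasTowerPressure.antitoneOn {E : LoopEnsemble} (hE : E ∈ latticeEnsembles)
    {e : ℝ → ℝ} {S : Set ℝ} (h : E.HasTowerPressure e S) (hS : S ⊆ Ici 0) : AntitoneOn e S := by
  intro u hu v hv huv
  by_contra hlt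
  have hlt : e u < e v := not_le.mp hlt
  set d := e v - e u with hd
  have hd0 : 0 < d := by linarith
  have hρ : ∀ᶠ ρ in 𝓝[>] (0 : ℝ), ρ < 1 := nhdsWithin_le_nhds (Iio_mem_nhds zero_lt_one)
  obtain ⟨ρ, ⟨⟨hρ0, hρ1⟩, hA⟩, hB⟩ :=
    (((eventually_mem_nhdsWithin.and hρ).and (h u hu (d / 4) (by linarith))).and
      (h v hv (d / 4) (by linarith))).exists
  have hρ0' : 0 < ρ := hρ0
  obtain ⟨δ, ⟨hA1, -⟩, hB1, hB2⟩ := (hA.and hB).exists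
  have hMv : 0 < E.towerMoment v δ ρ := lt_of_lt_of_le (Real.rpow_pos_of_pos hρ0' _) hB1
  have hint := integrable_of_towerMoment_ne_zero hMv.ne'
  have hmono := towerMoment_mono hE δ ρ (hS hu) huv hint
  have key : ρ ^ (e u + d / 4) ≤ ρ ^ (e v - d / 4) := hA1.trans (hmono.trans hB2)
  have := (Real.rpow_le_rpow_left_iff_of_base_lt_one hρ0' hρ1).mp key
  linarith

/-! ## §2 The family at the right end-point `u = √3` -/

/-- `arccos (√3/2) = π/6`. -/
theorem arccos_sqrt_three_div_two : Real.arccos (Real.sqrt 3 / 2) = π / 6 := by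
  rw [← Real.cos_pi_div_six, Real.arccos_cos (by positivity) (by linarith [Real.pi_pos])]

/-- The derivative of `u ↦ arccos (u/2)` at `u = √3` is `−1`. -/
theorem hasDerivAt_arccos_half_sqrt_three :
    HasDerivAt (fun u : ℝ ↦ Real.arccos (u / 2)) (-1) (Real.sqrt 3) := by
  have h3 : Real.sqrt 3 ^ 2 = 3 := Real.sq_sqrt (by norm_num)
  have hlt : Real.sqrt 3 < 2 := by
    rw [show (2 : ℝ) = Real.sqrt 4 by rw [show (4 : ℝ) = 2 ^ 2 by norm_num, Real.sqrt_sq (by norm_num)]]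
    exact Real.sqrt_lt_sqrt (by norm_num) (by norm_num)
  have hpos : 0 < Real.sqrt 3 := Real.sqrt_pos.mpr (by norm_num)
  have h1 : Real.sqrt 3 / 2 ≠ -1 := by intro h; linarith
  have h2 : Real.sqrt 3 / 2 ≠ 1 := by intro h; linarith
  have hd := Real.hasDerivAt_arccos h1 h2
  have hsq : Real.sqrt (1 - (Real.sqrt 3 / 2) ^ 2) = 1 / 2 := by
    rw [div_pow, h3, show (1 : ℝ) - 3 / 2 ^ 2 = (1 / 2) ^ 2 by norm_num, Real.sqrt_sq (by norm_num)]
  rw [hsq] at hd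
  have hlin : HasDerivAt (fun u : ℝ ↦ u / 2) (1 / 2) (Real.sqrt 3) := (hasDerivAt_id _).div_const 2
  exact (hd.comp (Real.sqrt 3) hlin).congr_deriv (show -(1 / (1 / 2 : ℝ)) * (1 / 2) = -1 by norm_num)

/-- `pressureFamily a` is differentiable at `√3` with derivative `1/(4π) − a`. -/
theorem hasDerivAt_pressureFamily_sqrt_three (a : ℝ) :
    HasDerivAt (pressureFamily a) (1 / (4 * π) - a) (Real.sqrt 3) := by
  have hG : HasDerivAt (fun u : ℝ ↦ Real.arccos (u / 2) - π / 3) (-1) (Real.sqrt 3) := by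
    simpa using hasDerivAt_arccos_half_sqrt_three.sub_const (π / 3)
  have hG0 : Real.arccos (Real.sqrt 3 / 2) - π / 3 = -(π / 6) := by
    rw [arccos_sqrt_three_div_two]; ring
  have h1 : HasDerivAt (fun u : ℝ ↦ 3 / (4 * π ^ 2) * (Real.arccos (u / 2) - π / 3) ^ 2)
      (3 / (4 * π ^ 2) * (2 * (Real.arccos (Real.sqrt 3 / 2) - π / 3) * (-1))) (Real.sqrt 3) := by
    have := (hG.pow 2).const_mul (3 / (4 * π ^ 2))
    simpa using this
  have h2 : HasDerivAt (fun u : ℝ ↦ a * (Real.arccos (u / 2) - π / 3)) (a * (-1)) (Real.sqrt 3) :=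
    hG.const_mul a
  have h12 : HasDerivAt (pressureFamily a)
      (3 / (4 * π ^ 2) * (2 * (Real.arccos (Real.sqrt 3 / 2) - π / 3) * (-1)) + a * (-1))
      (Real.sqrt 3) := h1.add h2
  refine h12.congr_deriv ?_
  rw [hG0]
  field_simp
  ring

/-- An antitone member of the family on `[0, √3]` has `a ≥ 1/(4π)` (non-positive left slopes at `√3`). -/
theorem inv_four_pi_le_of_antitoneOn {a : ℝ}
    (h : AntitoneOn (pressureFamily a) (Icc 0 (Real.sqrt 3))) : 1 / (4 * π) ≤ a := by
  have h0 : (0 : ℝ) < Real.sqrt 3 := Real.sqrt_pos.mpr (by norm_num)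
  have ht : Tendsto (slope (pressureFamily a) (Real.sqrt 3)) (𝓝[<] Real.sqrt 3)
      (𝓝 (1 / (4 * π) - a)) :=
    (hasDerivAt_iff_tendsto_slope.mp (hasDerivAt_pressureFamily_sqrt_three a)).mono_left
      (nhdsWithin_mono _ fun x hx ↦ ne_of_lt hx)
  have hev : ∀ᶠ u in 𝓝[<] Real.sqrt 3, slope (pressureFamily a) (Real.sqrt 3) u ≤ 0 := by
    filter_upwards [Ioo_mem_nhdsLT h0] with u hu
    rw [slope_def_field]
    have hle : pressureFamily a (Real.sqrt 3) ≤ pressureFamily a u :=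
      h ⟨hu.1.le, hu.2.le⟩ ⟨h0.le, le_rfl⟩ hu.2.le
    exact div_nonpos_iff.mpr (Or.inl ⟨by linarith, by linarith [hu.2]⟩)
  have := le_of_tendsto ht hev
  linarith

/-! ## §3 The excluded range of background charges -/

/-- **No lattice ensemble has a tower pressure `pressureFamily a` on `[0, √3]` with `a < 1/(4π)`.**
In particular the witness of stub S2 (`TowerPressureFamily`) automatically satisfies `1/(4π) ≤ a`. -/
theorem not_hasTowerPressure_pressureFamily_of_lt {E : LoopEnsemble} (hE : E ∈ latticeEnsembles)
    {a : ℝ} (ha : a < 1 / (4 * π)) :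
    ¬ E.HasTowerPressure (pressureFamily a) (Icc 0 (Real.sqrt 3)) := fun h ↦
  absurd (inv_four_pi_le_of_antitoneOn (h.antitoneOn hE fun _ hu ↦ hu.1)) (not_le.mpr ha)

/-- Positive reading of the same fact: the S2 witness is at least `1/(4π)`. -/
theorem inv_four_pi_le_of_hasTowerPressure {E : LoopEnsemble} (hE : E ∈ latticeEnsembles) {a : ℝ}
    (h : E.HasTowerPressure (pressureFamily a) (Icc 0 (Real.sqrt 3))) : 1 / (4 * π) ≤ a :=
  inv_four_pi_le_of_antitoneOn (h.antitoneOn hE fun _ hu ↦ hu.1)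

/-! ## §4 The branch point `u = 2` -/

/-- The deviation of a family member from `e6` is a pure multiple of `arccos(u/2) − π/3`. -/
theorem pressureFamily_sub_e6 (a u : ℝ) :
    pressureFamily a u - e6 u = (a - 1 / (2 * π)) * (Real.arccos (u / 2) - π / 3) := by
  simp only [pressureFamily, e6]
  field_simp
  ring

/-- The family in the angle variable: for `θ ∈ [0, π]`, `e_a(2 cos θ) = β(θ − π/3)² + a(θ − π/3)`. -/
theorem pressureFamily_two_mul_cos (a : ℝ) {θ : ℝ} (h0 : 0 ≤ θ) (hπ : θ ≤ π) :
    pressureFamily a (2 * Real.cos θ) = 3 / (4 * π ^ 2) * (θ - π / 3) ^ 2 + a * (θ - π / 3) := by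
  simp only [pressureFamily, mul_div_cancel_left₀ _ (two_ne_zero' ℝ), Real.arccos_cos h0 hπ]

/-- Value of the family at the branch point `u = 2`. -/
theorem pressureFamily_two (a : ℝ) : pressureFamily a 2 = 1 / 12 - a * (π / 3) := by
  have h : Real.arccos ((2 : ℝ) / 2) = 0 := by rw [div_self two_ne_zero, Real.arccos_one]
  simp only [pressureFamily, h]
  field_simp
  ring

/-- Value of `e6` at the branch point. -/
theorem e6_two : e6 2 = -1 / 12 := by
  have h : Real.arccos ((2 : ℝ) / 2) = 0 := by rw [div_self two_ne_zero, Real.arccos_one]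
  simp only [e6, h]
  norm_num

/-- **Square-root singularity at the branch point.** For `a ≠ 1/(2π)` the family member is not
Lipschitz from the left at `u = 2`, with ANY constant: in the angle `u = 2cos θ`,
`e_a(u) − e_a(2) = θ(βθ + (a − 1/(2π)))` is of order `θ ≍ √(2 − u)`. -/
theorem pressureFamily_not_leftLipschitz_two {a : ℝ} (ha : a ≠ 1 / (2 * π)) (K : ℝ) {η : ℝ}
    (hη : 0 < η) : ∃ u ∈ Ioo (2 - η) 2, K * (2 - u) < |pressureFamily a u - pressureFamily a 2| := by
  set β : ℝ := 3 / (4 * π ^ 2) with hβ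
  set c : ℝ := a - 1 / (2 * π) with hc
  have hc0 : c ≠ 0 := sub_ne_zero.mpr ha
  set C : ℝ := |c| with hC
  have hCpos : 0 < C := abs_pos.mpr hc0
  have hβpos : 0 < β := by positivity
  set θ : ℝ := min (1 / 2) (min (η / 2) (min (C / (4 * β)) (C / (4 * (|K| + 1))))) with hθ
  have hθpos : 0 < θ :=
    lt_min (by norm_num) (lt_min (by linarith) (lt_min (by positivity) (by positivity)))
  have hθ_half : θ ≤ 1 / 2 := min_le_left _ _
  have hθ_η : θ ≤ η / 2 := (min_le_right _ _).trans (min_le_left _ _)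
  have hθ_C : θ ≤ C / (4 * β) :=
    ((min_le_right _ _).trans (min_le_right _ _)).trans (min_le_left _ _)
  have hθ_K : θ ≤ C / (4 * (|K| + 1)) :=
    ((min_le_right _ _).trans (min_le_right _ _)).trans (min_le_right _ _)
  have hθπ : θ ≤ π := by linarith [Real.pi_gt_three]
  have hcos := Real.one_sub_sq_div_two_le_cos (x := θ)
  refine ⟨2 * Real.cos θ, ⟨?_, ?_⟩, ?_⟩
  · have hθ2 : θ ^ 2 < η := by nlinarith
    nlinarith
  · have : Real.cos θ < Real.cos 0 := Real.cos_lt_cos_of_nonneg_of_le_pi le_rfl hθπ hθpos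
    rw [Real.cos_zero] at this
    linarith
  · rw [pressureFamily_two_mul_cos a hθpos.le hθπ, pressureFamily_two]
    have hD : 3 / (4 * π ^ 2) * (θ - π / 3) ^ 2 + a * (θ - π / 3) - (1 / 12 - a * (π / 3)) =
        θ * (β * θ + c) := by
      rw [hβ, hc]
      field_simp
      ring
    rw [hD]
    have hβθ : β * θ * 4 ≤ C := by
      have := (le_div_iff₀ (by positivity)).mp hθ_C
      linarith
    have habs : 3 / 4 * C * θ ≤ |θ * (β * θ + c)| := by
      rw [abs_mul, abs_of_pos hθpos]
      rcases lt_or_gt_of_ne hc0 with hneg | hpos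
      · have hCc : C = -c := abs_of_neg hneg
        have h2 : 3 / 4 * C ≤ |β * θ + c| := by
          rw [abs_of_neg (by linarith)]
          linarith
        nlinarith [h2, hθpos]
      · have hCc : C = c := abs_of_pos hpos
        have h2 : 3 / 4 * C ≤ |β * θ + c| := by
          rw [abs_of_pos (by nlinarith)]
          nlinarith
        nlinarith [h2, hθpos]
    have h2u : 2 - 2 * Real.cos θ ≤ θ ^ 2 := by linarith
    have h2u0 : 0 ≤ 2 - 2 * Real.cos θ := by linarith [Real.cos_le_one θ]
    have hK1 : K * (2 - 2 * Real.cos θ) ≤ |K| * θ ^ 2 :=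
      calc K * (2 - 2 * Real.cos θ) ≤ |K| * (2 - 2 * Real.cos θ) :=
            mul_le_mul_of_nonneg_right (le_abs_self K) h2u0
        _ ≤ |K| * θ ^ 2 := mul_le_mul_of_nonneg_left h2u (abs_nonneg K)
    have hθK' : θ * (4 * (|K| + 1)) ≤ C := (le_div_iff₀ (by positivity)).mp hθ_K
    have hK2 : |K| * θ ^ 2 < 3 / 4 * C * θ := by
      nlinarith [mul_le_mul_of_nonneg_left hθK' hθpos.le, abs_nonneg K, sq_pos_of_pos hθpos]
    calc K * (2 - 2 * Real.cos θ) ≤ |K| * θ ^ 2 := hK1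
      _ < 3 / 4 * C * θ := hK2
      _ ≤ |θ * (β * θ + c)| := habs

/-- `e6` (the member `a = 1/(2π)`) IS Lipschitz from the left at the branch point:
`|e6 u − e6 2| ≤ (3/16)(2 − u)` on `[0, 2]` (Jordan's inequality for `arccos(u/2)`). -/
theorem e6_sub_e6_two_le {u : ℝ} (h0 : 0 ≤ u) (h2 : u ≤ 2) : |e6 u - e6 2| ≤ 3 / 16 * (2 - u) := by
  set g := Real.arccos (u / 2) with hg
  have hg0 : 0 ≤ g := Real.arccos_nonneg _
  have hgπ : g ≤ π / 2 := Real.arccos_le_pi_div_two.mpr (by linarith)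
  have hdiff : e6 u - e6 2 = 3 / (4 * π ^ 2) * g ^ 2 := by
    rw [e6_two]
    simp only [e6, ← hg]
    field_simp
    ring
  have hsin : Real.sin g = Real.sqrt (1 - (u / 2) ^ 2) := Real.sin_arccos _
  have hjordan : 2 / π * g ≤ Real.sin g := Real.mul_le_sin hg0 hgπ
  have hsq : Real.sqrt (1 - (u / 2) ^ 2) ^ 2 = 1 - (u / 2) ^ 2 := Real.sq_sqrt (by nlinarith)
  have hπ := Real.pi_pos
  have hg_le : g ≤ π / 2 * Real.sqrt (1 - (u / 2) ^ 2) := by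
    rw [← hsin]
    rw [div_mul_eq_mul_div, div_le_iff₀ hπ] at hjordan
    nlinarith
  have hg2 : g ^ 2 ≤ π ^ 2 / 4 * (2 - u) := by
    have h1 : g ^ 2 ≤ (π / 2 * Real.sqrt (1 - (u / 2) ^ 2)) ^ 2 := pow_le_pow_left₀ hg0 hg_le 2
    rw [mul_pow, hsq] at h1
    nlinarith [Real.pi_pos]
  rw [hdiff, abs_of_nonneg (by positivity)]
  calc 3 / (4 * π ^ 2) * g ^ 2 ≤ 3 / (4 * π ^ 2) * (π ^ 2 / 4 * (2 - u)) :=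
        mul_le_mul_of_nonneg_left hg2 (by positivity)
    _ = 3 / 16 * (2 - u) := by
        field_simp
        ring

/-- **Quantisation criterion at the branch point.** If SOME function `θ` that is Lipschitz from the
left at `u = 2` agrees with `pressureFamily a` on a left neighbourhood of `2` and at `2`, then
`a = 1/(2π)` — the algebraic core common to the three quantisation devices of the S3 docstring. -/
theorem eq_inv_two_pi_of_leftLipschitz {a K η : ℝ} (hη : 0 < η) {θ : ℝ → ℝ}
    (hagree : ∀ u ∈ Ioo (2 - η) 2, θ u = pressureFamily a u) (h2 : θ 2 = pressureFamily a 2)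
    (hLip : ∀ u ∈ Ioo (2 - η) 2, |θ u - θ 2| ≤ K * (2 - u)) : a = 1 / (2 * π) := by
  by_contra ha
  obtain ⟨u, hu, hlt⟩ := pressureFamily_not_leftLipschitz_two ha K hη
  have := hLip u hu
  rw [hagree u hu, h2] at this
  linarith

/-! ## §5 Log-convexity of tower moments (Cauchy–Schwarz) -/

/-- **Cauchy–Schwarz for tower moments**: on a lattice ensemble, for non-negative weights with integrable
integrands, `E_δ[√(uv)^N]² ≤ E_δ[u^N] · E_δ[v^N]`. -/
theorem towerMoment_sqrt_mul_sq_le {E : LoopEnsemble} (hE : E ∈ latticeEnsembles) (δ ρ : ℝ) {u v : ℝ}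
    (hu : 0 ≤ u) (hv : 0 ≤ v) (hiu : Integrable (fun ω ↦ u ^ towerCount (E.X δ ω) 0 ρ 1) E.P)
    (hiv : Integrable (fun ω ↦ v ^ towerCount (E.X δ ω) 0 ρ 1) E.P) :
    E.towerMoment (Real.sqrt (u * v)) δ ρ ^ 2 ≤ E.towerMoment u δ ρ * E.towerMoment v δ ρ := by
  have hmN : Measurable fun ω ↦ towerCount (E.X δ ω) 0 ρ 1 := measurable_towerCount E hE δ 0 ρ 1
  have hf_meas : AEStronglyMeasurable (fun ω ↦ Real.sqrt u ^ towerCount (E.X δ ω) 0 ρ 1) E.P :=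
    (hmN.const_pow _).aestronglyMeasurable
  have hg_meas : AEStronglyMeasurable (fun ω ↦ Real.sqrt v ^ towerCount (E.X δ ω) 0 ρ 1) E.P :=
    (hmN.const_pow _).aestronglyMeasurable
  have hf2 : ∀ ω, (Real.sqrt u ^ towerCount (E.X δ ω) 0 ρ 1) ^ 2 = u ^ towerCount (E.X δ ω) 0 ρ 1 :=
    fun ω ↦ by rw [← pow_mul, mul_comm, pow_mul, Real.sq_sqrt hu]
  have hg2 : ∀ ω, (Real.sqrt v ^ towerCount (E.X δ ω) 0 ρ 1) ^ 2 = v ^ towerCount (E.X δ ω) 0 ρ 1 :=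
    fun ω ↦ by rw [← pow_mul, mul_comm, pow_mul, Real.sq_sqrt hv]
  have hfg : ∀ ω, Real.sqrt u ^ towerCount (E.X δ ω) 0 ρ 1 * Real.sqrt v ^ towerCount (E.X δ ω) 0 ρ 1 =
      Real.sqrt (u * v) ^ towerCount (E.X δ ω) 0 ρ 1 :=
    fun ω ↦ by rw [← mul_pow, Real.sqrt_mul hu]
  have hfL2 : MemLp (fun ω ↦ Real.sqrt u ^ towerCount (E.X δ ω) 0 ρ 1) (ENNReal.ofReal 2) E.P := by
    rw [ENNReal.ofReal_ofNat, memLp_two_iff_integrable_sq hf_meas]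
    simpa only [hf2] using hiu
  have hgL2 : MemLp (fun ω ↦ Real.sqrt v ^ towerCount (E.X δ ω) 0 ρ 1) (ENNReal.ofReal 2) E.P := by
    rw [ENNReal.ofReal_ofNat, memLp_two_iff_integrable_sq hg_meas]
    simpa only [hg2] using hiv
  have key := integral_mul_le_Lp_mul_Lq_of_nonneg Real.HolderConjugate.two_two
    (Eventually.of_forall fun ω ↦ pow_nonneg (Real.sqrt_nonneg u) (towerCount (E.X δ ω) 0 ρ 1))
    (Eventually.of_forall fun ω ↦ pow_nonneg (Real.sqrt_nonneg v) (towerCount (E.X δ ω) 0 ρ 1))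
    hfL2 hgL2
  simp only [Real.rpow_two, hf2, hg2, hfg] at key
  have hMu : 0 ≤ E.towerMoment u δ ρ := integral_nonneg fun ω ↦ pow_nonneg hu _
  have hMv : 0 ≤ E.towerMoment v δ ρ := integral_nonneg fun ω ↦ pow_nonneg hv _
  have hMw : 0 ≤ E.towerMoment (Real.sqrt (u * v)) δ ρ :=
    integral_nonneg fun ω ↦ pow_nonneg (Real.sqrt_nonneg _) _
  change E.towerMoment (Real.sqrt (u * v)) δ ρ ≤
    E.towerMoment u δ ρ ^ (1 / 2 : ℝ) * E.towerMoment v δ ρ ^ (1 / 2 : ℝ) at key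
  calc E.towerMoment (Real.sqrt (u * v)) δ ρ ^ 2
      ≤ (E.towerMoment u δ ρ ^ (1 / 2 : ℝ) * E.towerMoment v δ ρ ^ (1 / 2 : ℝ)) ^ 2 :=
        pow_le_pow_left₀ hMw key 2
    _ = E.towerMoment u δ ρ * E.towerMoment v δ ρ := by
        rw [mul_pow, ← Real.rpow_natCast (E.towerMoment u δ ρ ^ (1 / 2 : ℝ)),
          ← Real.rpow_natCast (E.towerMoment v δ ρ ^ (1 / 2 : ℝ)), ← Real.rpow_mul hMu,
          ← Real.rpow_mul hMv]
        norm_num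

/-- **Tower pressures are midpoint-concave in `log u`.** For both lattice ensembles and any sandwich
exponent function `e` on a set `S` of non-negative weights: if `u, v` and their geometric mean lie in `S`
then `e u + e v ≤ 2 e(√(uv))` (the exponent-level shadow of the log-convexity of `u ↦ E[u^N]`). -/
theorem LoopEnsemble.HasTowerPressure.add_le_two_mul {E : LoopEnsemble} (hE : E ∈ latticeEnsembles)
    {e : ℝ → ℝ} {S : Set ℝ} (h : E.HasTowerPressure e S) (hS : S ⊆ Ici 0) {u v : ℝ} (hu : u ∈ S)
    (hv : v ∈ S) (hw : Real.sqrt (u * v) ∈ S) : e u + e v ≤ 2 * e (Real.sqrt (u * v)) := by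
  by_contra hlt
  have hlt : 2 * e (Real.sqrt (u * v)) < e u + e v := not_le.mp hlt
  set w := Real.sqrt (u * v) with hwdef
  set d := e u + e v - 2 * e w with hd
  have hd0 : 0 < d := by linarith
  have hρ : ∀ᶠ ρ in 𝓝[>] (0 : ℝ), ρ < 1 := nhdsWithin_le_nhds (Iio_mem_nhds zero_lt_one)
  obtain ⟨ρ, ⟨⟨⟨hρ0, hρ1⟩, hA⟩, hB⟩, hC⟩ :=
    ((((eventually_mem_nhdsWithin.and hρ).and (h u hu (d / 8) (by linarith))).and
      (h v hv (d / 8) (by linarith))).and (h w hw (d / 8) (by linarith))).exists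
  have hρ0' : 0 < ρ := hρ0
  obtain ⟨δ, ⟨hA1, hA2⟩, ⟨hB1, hB2⟩, hC1, -⟩ := (hA.and (hB.and hC)).exists
  have hMu : 0 < E.towerMoment u δ ρ := lt_of_lt_of_le (Real.rpow_pos_of_pos hρ0' _) hA1
  have hMv : 0 < E.towerMoment v δ ρ := lt_of_lt_of_le (Real.rpow_pos_of_pos hρ0' _) hB1
  have hiu := integrable_of_towerMoment_ne_zero hMu.ne'
  have hiv := integrable_of_towerMoment_ne_zero hMv.ne'
  have cs := towerMoment_sqrt_mul_sq_le hE δ ρ (hS hu) (hS hv) hiu hiv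
  have lower : ρ ^ ((e w + d / 8) * 2) ≤ E.towerMoment w δ ρ ^ 2 := by
    rw [Real.rpow_mul hρ0'.le, Real.rpow_two]
    exact pow_le_pow_left₀ (Real.rpow_nonneg hρ0'.le _) hC1 2
  have upper : E.towerMoment u δ ρ * E.towerMoment v δ ρ ≤ ρ ^ (e u - d / 8 + (e v - d / 8)) := by
    rw [Real.rpow_add hρ0']
    exact mul_le_mul hA2 hB2 hMv.le (Real.rpow_nonneg hρ0'.le _)
  have key := (Real.rpow_le_rpow_left_iff_of_base_lt_one hρ0' hρ1).mp (lower.trans (cs.trans upper))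
  linarith

end Summit.CriticalPhenomena.CardyFormulaZ2.Cruxes.NestingRigidity.RingCloudTomography

end
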